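import Summits.HodgeConjecture.HodgeConjecture.Theorems.F0P3SLayerFoldShapes
import Summits.HodgeConjecture.HodgeConjecture.Theorems.F0P3ArchModuleIsotypic
import Summits.HodgeConjecture.HodgeConjecture.Theorems.F0P3StubF1aCM
import Literature.RepresentationTheory.BorelWallach2000.U11DiscreteSeriesCoefficientsIrreducible
import HarnessLib

/-!
# Crux `H413` — ENGINE-side archimedean SEAM in token currency: the cohomology TOKENS of ONE discrete `P` are all
# `(𝔤, K)`-EQUIVALENT, hence carry ONE degree-one sign (the DIAGONAL of the relative sign letter R♭, in-house)

Floor-0 programme P3 «U3-mult», seat F0P3-p01 (g5); crux item stmt-HodgeConjecture-24833 (`HCCMUnconditional.H413`); line of record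
`Cruxes/H413/Lines/F0_U3LettersRung1.lean` ed. 2.7 (open stubs `stub_E1 : StubE1coh`, `stub_betaOpp : StubBetaOpp`); F0P3-plan (g3)
rulings (L2) (K3 banked), 05:04:52Z GO (O1), (Q2) (the sign letter goes RELATIVE: R♭ `memAPacket_cohTokens_sameType`).
PROOF lane: no `def`, no `sorry`, no named fact asserted; `--supports stmt-HodgeConjecture-24833`.
HONEST LABEL: HC_CM is proved only modulo the printed citations until rung 0 closes.

A **token** of `P` (β ∕ β_opp ∕ S2♭ ∕ R♭ currency, ★ `F0P3SLayerFoldShapes` §1) is an IRREDUCIBLE `(𝔤, K)`-module `(M, σK, σ𝔤)` of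
`U(2,1)_{Fin 2 ⊕ Fin 1}` receiving a NON-ZERO `(𝔤, K)`-map `T₁ : P.archModuleCM ι T hT → M`.

* §1 (generic `(𝔤, K)`-algebra over any real matrix group `G`; symmetry∕transitivity of `AreGKEquivalent` are ★ `AreGKEquivalent.symm'`∕`trans'`)
  **`areGKEquivalent_of_quotient_of_cogenerated`**: if a `(𝔤, K)`-module `V` is
  COGENERATED by an irreducible admissible `M_det` (letter F1a's pointwise currency) then every irreducible `(𝔤, K)`-module receiving a
  non-zero `(𝔤, K)`-map from `V` is `(𝔤, K)`-equivalent to `M_det` — `V` is a semisimple `M_det`-ISOTYPIC `GKRing G`-module (★ R2♯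
  `F0P3ArchModuleIsotypic.isIsotypicOfType_of_cogenerated`), a non-zero map is non-zero on some simple submodule `S ≅ M_det`
  (Mathlib `IsSemisimpleModule.sSup_simples_eq_top`), and `S → M` is then an isomorphism (Schur, Mathlib `LinearMap.bijective_or_eq_zero`).
* §2 (the CM pin, letter F1a `P.ArchIsotypy … (cmArchSectionUForm …)` as hypothesis) **`areGKEquivalent_of_tokens`**: two tokens of the
  same `P` are `(𝔤, K)`-equivalent (both ≅ the detecting module of ★ `F0P3ArchIsotypyCM.exists_detecting_irreducible`); hence
  **`upqType_eq_of_tokens`**: if they carry degree-one classes of types `δ, δ′ ∈ {±1}` then `δ = δ′` (★ `hol_antihol_inequivalent_of_irreducible`,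
  T6a purity) — the DIAGONAL `P = P′` of R♭, with no packet vocabulary and no admissibility ∕ unitarity of the tokens.
* §3 (the COMPACT CM datum `hdef`, `h2`: F1a is ★ IN-HOUSE for `H¹`-cohomological `P`, ★ `F0P3StubF1aCM.stubF1aCM_holds`)
  **`upqType_eq_of_tokens_cpt`** (hol ∨ antihol `P`), **`token_type_eq_one_of_isHolCotangentAt_cpt`** ∕ **`token_type_eq_neg_one_of_isAntiholCotangentAt_cpt`**:
  every token of a holomorphic-type `P` has its degree-one classes in type `+1` only (antiholomorphic: `−1` only) — by §2 against the ★ K4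
  token producers `exists_cohToken_of_isHolCotangentAt_cpt` ∕ `…Antihol…`.
(The UNITARY representative `gen(Φ)` and the seam to P3b's `J⁺` are the sequel ★-pending `F0P3ArchTokenUnitary`.)

References: [Rogawski1990] Prop. 15.2.1 (b), §12.3 p. 178, §15.3; [BorelWallach2000] II §4.2, VI Thm. 4.11; [FlathCorvallis1979] Thm. 3–4;
[BourbakiAlgebreVIII2012] VIII §4 n°1–2; [KnappVogan1995] Ch. I §3, App. A (A.17).
-/

set_option autoImplicit false
-- the mandated namespace repeats `HodgeConjecture.HodgeConjecture`, as in every `Theorems/*.lean` of this sub-problem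
set_option linter.dupNamespace false

-- Mathlib idiom (as in ★ `GKModules`, the `Upq*` files and every `(𝔤, K)` file of this sub-problem): commutator bracket on `Module.End`
attribute [local instance 100] LieRing.ofAssociativeRing

noncomputable section

namespace Summit.HodgeConjecture.HodgeConjecture.Cruxes.H413.F0P3ArchTokenSeam

open NumberField NumberField.InfinitePlace MeasureTheory
open scoped Matrix MatrixGroups ComplexOrder
open Literature.NumberTheory.Automorphic Literature.NumberTheory.Automorphic.UnitaryGroup
open Literature.NumberTheory.Automorphic.UnitaryGroup.CotangentForms (cmArchSection cmCompactFactor)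
open Literature.RepresentationTheory.BorelWallach2000
open Literature.RepresentationTheory.KonnoKonno2007 Literature.RepresentationTheory.KonnoKonno2007.RealDualPair
open Literature.RepresentationTheory.KonnoKonno2007.RealDualPair.UForm
open Summit.HodgeConjecture.HodgeConjecture.Cruxes.H413.F0P3ArchModuleIsotypic
open Summit.HodgeConjecture.HodgeConjecture.Cruxes.H413.F0P3ArchIsotypyCM
open Summit.HodgeConjecture.HodgeConjecture.Cruxes.H413.F0P3bArchDegOnePackage
open Summit.HodgeConjecture.HodgeConjecture.Cruxes.H413.F0P3SLayerFoldShapes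

/-! ## §1 Generic: irreducible quotients of a cogenerated (= isotypic) `(𝔤, K)`-module -/

section GK

variable {A : Type*} [NormedCommRing A] [NormedAlgebra ℝ A] [NormedAlgebra ℚ A] [CompleteSpace A]
  [StarRing A] [StarModule ℝ A] [ContinuousStar A] {N : Type*} [Fintype N] [DecidableEq N] {G : RealMatrixGroup A N}
  {V : Type} [AddCommGroup V] [Module ℂ V]
  {ρK : Representation ℂ G.maximalCompact V} {ρ𝔤 : G.lie →ₗ⁅ℝ⁆ Module.End ℂ V}
  {M : Type} [AddCommGroup M] [Module ℂ M]
  {σK : Representation ℂ G.maximalCompact M} {σ𝔤 : G.lie →ₗ⁅ℝ⁆ Module.End ℂ M}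
  {M' : Type} [AddCommGroup M'] [Module ℂ M']
  {τK : Representation ℂ G.maximalCompact M'} {τ𝔤 : G.lie →ₗ⁅ℝ⁆ Module.End ℂ M'}
  {M'' : Type} [AddCommGroup M''] [Module ℂ M'']
  {υK : Representation ℂ G.maximalCompact M''} {υ𝔤 : G.lie →ₗ⁅ℝ⁆ Module.End ℂ M''}

/-- **Irreducible quotients of a cogenerated module.**  Let the `(𝔤, K)`-module `(V, ρK, ρ𝔤)` be COGENERATED by the irreducible
admissible `(M, σK, σ𝔤)` (every non-zero `v ∈ V` is detected by some `(𝔤, K)`-map `V → M`: letter F1a's pointwise currency), and let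
`(M′, τK, τ𝔤)` be irreducible receiving a NON-ZERO `(𝔤, K)`-map `T : V → M′`.  Then `M′` is `(𝔤, K)`-equivalent to `M`.
Proof: `V` is a semisimple `M`-isotypic `GKRing G`-module (★ R2♯ `isSemisimpleModule_of_cogenerated` ∕ `isIsotypicOfType_of_cogenerated`,
Bourbaki VIII §4); the simple submodules of `V` span it (`sSup_simples_eq_top`), so `T` is non-zero on some simple `S ≤ V`, `S ≅ M`;
`T|_S : S → M′` is then a non-zero map between simple modules, an isomorphism (Schur). [cite: BourbakiAlgebreVIII2012, VIII §4 n°1–2]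
[cite: KnappVogan1995, App. A §3 (A.17)] -/
theorem areGKEquivalent_of_quotient_of_cogenerated (hV : IsGKModule G ρK ρ𝔤)
    (hirr : IsIrreducibleGK σK σ𝔤) (hadm : IsAdmissibleGK σK)
    (hcog : ∀ v : V, v ≠ 0 → ∃ φ : V →ₗ[ℂ] M,
      (∀ (k : G.maximalCompact) (w : V), φ (ρK k w) = σK k (φ w)) ∧
        (∀ (X : G.lie) (w : V), φ (ρ𝔤 X w) = σ𝔤 X (φ w)) ∧ φ v ≠ 0)
    (hirr' : IsIrreducibleGK τK τ𝔤) (T : V →ₗ[ℂ] M')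
    (hTK : ∀ (k : G.maximalCompact) (v : V), T (ρK k v) = τK k (T v))
    (hT𝔤 : ∀ (X : G.lie) (v : V), T (ρ𝔤 X v) = τ𝔤 X (T v)) (hT : T ≠ 0) :
    AreGKEquivalent τK τ𝔤 σK σ𝔤 := by
  haveI : IsSimpleModule (GKRing G) (GKRing.asModule σK σ𝔤) := (GKRing.isIrreducibleGK_iff_isSimpleModule_asModule σK σ𝔤).mp hirr
  haveI : IsSimpleModule (GKRing G) (GKRing.asModule τK τ𝔤) := (GKRing.isIrreducibleGK_iff_isSimpleModule_asModule τK τ𝔤).mp hirr'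
  haveI : IsSemisimpleModule (GKRing G) (GKRing.asModule ρK ρ𝔤) :=
    isSemisimpleModule_of_cogenerated ρK ρ𝔤 σK σ𝔤 hV hirr hadm hcog
  have hiso := isIsotypicOfType_of_cogenerated ρK ρ𝔤 σK σ𝔤 hV hirr hadm hcog
  let T' : GKRing.asModule ρK ρ𝔤 →ₗ[GKRing G] GKRing.asModule τK τ𝔤 := GKRing.mkLinearMapAsModule ρK ρ𝔤 τK τ𝔤 T hTK hT𝔤
  -- some simple submodule is not killed by `T'`
  obtain ⟨S, hS, hSk⟩ : ∃ S : Submodule (GKRing G) (GKRing.asModule ρK ρ𝔤),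
      IsSimpleModule (GKRing G) S ∧ ¬ S ≤ LinearMap.ker T' := by
    by_contra h
    push Not at h
    apply hT
    have htop : (⊤ : Submodule (GKRing G) (GKRing.asModule ρK ρ𝔤)) ≤ LinearMap.ker T' := by
      rw [← IsSemisimpleModule.sSup_simples_eq_top (GKRing G) (GKRing.asModule ρK ρ𝔤)]
      exact sSup_le fun S hS => h S hS
    ext v
    have hv := htop (Submodule.mem_top : (GKRing.asModuleEquiv ρK ρ𝔤).symm v ∈ ⊤)
    rw [LinearMap.mem_ker, GKRing.mkLinearMapAsModule_apply, LinearEquiv.apply_symm_apply,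
      LinearEquiv.map_eq_zero_iff] at hv
    rw [hv, LinearMap.zero_apply]
  haveI := hS
  have hne : T'.domRestrict S ≠ 0 := by
    intro h0
    apply hSk
    intro x hx
    rw [LinearMap.mem_ker]
    have := LinearMap.congr_fun h0 ⟨x, hx⟩
    rwa [LinearMap.domRestrict_apply, LinearMap.zero_apply] at this
  rcases LinearMap.bijective_or_eq_zero (R := GKRing G) (M := ↥S) (N := GKRing.asModule τK τ𝔤) (T'.domRestrict S) with hb | h0
  · obtain ⟨e⟩ := hiso S
    exact (GKRing.areGKEquivalent_iff_nonempty_linearEquiv_asModule τK τ𝔤 σK σ𝔤).2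
      ⟨(LinearEquiv.ofBijective _ hb).symm.trans e⟩
  · exact absurd h0 hne

end GK

/-! ## §2 The CM pin: tokens of one `P` are equivalent and carry one sign (letter F1a as hypothesis) -/

section Pin

variable {L : Type} [Field L] [NumberField L] [IsCMField L] (ι : L →+* ℂ) {H : Matrix (Fin 3) (Fin 3) L}
  (T : GL (Fin 3) ℂ) (hT : (T : Matrix (Fin 3) (Fin 3) ℂ)ᴴ * H.map ι * (T : Matrix (Fin 3) (Fin 3) ℂ) = Literature.Geometry.ComplexHyperbolic.BallModel.J)
  {μ : Measure (adelicGroupData (↥(maximalRealSubfield L)) L (IsCMField.complexConj L) 3 H).automorphicQuotient}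
  [(adelicGroupData (↥(maximalRealSubfield L)) L (IsCMField.complexConj L) 3 H).IsAutomorphicMeasure μ]
  (P : DiscreteAutomorphicRep (adelicGroupData (↥(maximalRealSubfield L)) L (IsCMField.complexConj L) 3 H) μ)
  {M : Type} [AddCommGroup M] [Module ℂ M]
  {σK : Representation ℂ (uFormGroup (Fin 2) (Fin 1)).maximalCompact M}
  {σ𝔤 : (uFormGroup (Fin 2) (Fin 1)).lie →ₗ⁅ℝ⁆ Module.End ℂ M}
  {M' : Type} [AddCommGroup M'] [Module ℂ M']
  {σK' : Representation ℂ (uFormGroup (Fin 2) (Fin 1)).maximalCompact M'}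
  {σ𝔤' : (uFormGroup (Fin 2) (Fin 1)).lie →ₗ⁅ℝ⁆ Module.End ℂ M'}

/-- **Every token of `P` is `(𝔤, K)`-equivalent to the detecting module of letter F1a**: if `P.ArchIsotypy` holds along the CM section
(★ named fact F1a; ★ PROVED in-house for `H¹`-cohomological `P` on the compact datum), an irreducible `(M, σK, σ𝔤)` receiving a non-zero
`(𝔤, K)`-map from `P.archModuleCM ι T hT` is equivalent to EVERY irreducible admissible module cogenerating `P.archModuleCM ι T hT`
(§1 at `V := P.archModuleCM ι T hT`, ★ `isGKModule_archModuleCM`). [cite: FlathCorvallis1979, Thm. 3 and Thm. 4] [cite: BourbakiAlgebreVIII2012, VIII §4 n°1–2] -/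
theorem areGKEquivalent_token_of_cogenerated
    {Md : Type} [AddCommGroup Md] [Module ℂ Md]
    {σKd : Representation ℂ (uFormGroup (Fin 2) (Fin 1)).maximalCompact Md}
    {σ𝔤d : (uFormGroup (Fin 2) (Fin 1)).lie →ₗ⁅ℝ⁆ Module.End ℂ Md}
    (hirrd : IsIrreducibleGK σKd σ𝔤d) (hadmd : IsAdmissibleGK σKd)
    (hdet : ∀ v : P.archModuleCM ι T hT, v ≠ 0 →
      ∃ φ : P.archModuleCM ι T hT →ₗ[ℂ] Md,
        (∀ (k : (uFormGroup (Fin 2) (Fin 1)).maximalCompact) (w : P.archModuleCM ι T hT),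
            φ (P.archRepKCM ι T hT k w) = σKd k (φ w)) ∧
          (∀ (X : (uFormGroup (Fin 2) (Fin 1)).lie) (w : P.archModuleCM ι T hT),
            φ (P.archRepLieCM ι T hT X w) = σ𝔤d X (φ w)) ∧ φ v ≠ 0)
    (hirr : IsIrreducibleGK σK σ𝔤) (T₁ : P.archModuleCM ι T hT →ₗ[ℂ] M)
    (hT₁K : ∀ (k : (uFormGroup (Fin 2) (Fin 1)).maximalCompact) (w : P.archModuleCM ι T hT),
      T₁ (P.archRepKCM ι T hT k w) = σK k (T₁ w))
    (hT₁𝔤 : ∀ (X : (uFormGroup (Fin 2) (Fin 1)).lie) (w : P.archModuleCM ι T hT),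
      T₁ (P.archRepLieCM ι T hT X w) = σ𝔤 X (T₁ w))
    (hT₁ : T₁ ≠ 0) : AreGKEquivalent σK σ𝔤 σKd σ𝔤d :=
  areGKEquivalent_of_quotient_of_cogenerated (P.isGKModule_archModuleCM ι T hT) hirrd hadmd hdet hirr T₁ hT₁K hT₁𝔤 hT₁

/-- **Two tokens of the same `P` are `(𝔤, K)`-equivalent** (letter F1a at the CM section as hypothesis): both are equivalent to the
detecting irreducible admissible module of ★ `exists_detecting_irreducible`. [cite: FlathCorvallis1979, Thm. 3 and Thm. 4]
[cite: BourbakiAlgebreVIII2012, VIII §4 n°1–2] -/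
theorem areGKEquivalent_of_tokens
    (hF1a : P.ArchIsotypy (uFormGroup (Fin 2) (Fin 1)) (cmArchSectionUForm L ι H T hT))
    (hirr : IsIrreducibleGK σK σ𝔤) (T₁ : P.archModuleCM ι T hT →ₗ[ℂ] M)
    (hT₁K : ∀ (k : (uFormGroup (Fin 2) (Fin 1)).maximalCompact) (w : P.archModuleCM ι T hT),
      T₁ (P.archRepKCM ι T hT k w) = σK k (T₁ w))
    (hT₁𝔤 : ∀ (X : (uFormGroup (Fin 2) (Fin 1)).lie) (w : P.archModuleCM ι T hT),
      T₁ (P.archRepLieCM ι T hT X w) = σ𝔤 X (T₁ w))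
    (hT₁ : T₁ ≠ 0)
    (hirr' : IsIrreducibleGK σK' σ𝔤') (T₂ : P.archModuleCM ι T hT →ₗ[ℂ] M')
    (hT₂K : ∀ (k : (uFormGroup (Fin 2) (Fin 1)).maximalCompact) (w : P.archModuleCM ι T hT),
      T₂ (P.archRepKCM ι T hT k w) = σK' k (T₂ w))
    (hT₂𝔤 : ∀ (X : (uFormGroup (Fin 2) (Fin 1)).lie) (w : P.archModuleCM ι T hT),
      T₂ (P.archRepLieCM ι T hT X w) = σ𝔤' X (T₂ w))
    (hT₂ : T₂ ≠ 0) : AreGKEquivalent σK σ𝔤 σK' σ𝔤' := by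
  obtain ⟨Md, i₁, i₂, σKd, σ𝔤d, -, hirrd, hadmd, hdet⟩ := exists_detecting_irreducible ι T hT P hF1a
  exact (areGKEquivalent_token_of_cogenerated ι T hT P hirrd hadmd hdet hirr T₁ hT₁K hT₁𝔤 hT₁).trans'
    (areGKEquivalent_token_of_cogenerated ι T hT P hirrd hadmd hdet hirr' T₂ hT₂K hT₂𝔤 hT₂).symm'

/-- **ONE SIGN PER `P` (the diagonal of R♭, in-house).**  Letter F1a at the CM section as hypothesis: if two tokens `(M, σK, σ𝔤)`,
`(M′, σK′, σ𝔤′)` of the SAME discrete `P` carry non-zero degree-one classes of types `δ, δ′ ∈ {±1}`, then `δ = δ′` — the tokens are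
`(𝔤, K)`-equivalent (`areGKEquivalent_of_tokens`) and an irreducible module with a type-`(+1)` class is never equivalent to an irreducible
one with a type-`(−1)` class (★ `hol_antihol_inequivalent_of_irreducible`, T6a purity).  No admissibility, no unitarity, no packet.
[cite: Rogawski1990, Prop. 15.2.1 (b)] [cite: BorelWallach2000, II §4.2 (3); VI Thm. 4.11] -/
theorem upqType_eq_of_tokens
    (hF1a : P.ArchIsotypy (uFormGroup (Fin 2) (Fin 1)) (cmArchSectionUForm L ι H T hT))
    (hM : IsGKModule (uFormGroup (Fin 2) (Fin 1)) σK σ𝔤) (hirr : IsIrreducibleGK σK σ𝔤)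
    (T₁ : P.archModuleCM ι T hT →ₗ[ℂ] M)
    (hT₁K : ∀ (k : (uFormGroup (Fin 2) (Fin 1)).maximalCompact) (w : P.archModuleCM ι T hT),
      T₁ (P.archRepKCM ι T hT k w) = σK k (T₁ w))
    (hT₁𝔤 : ∀ (X : (uFormGroup (Fin 2) (Fin 1)).lie) (w : P.archModuleCM ι T hT),
      T₁ (P.archRepLieCM ι T hT X w) = σ𝔤 X (T₁ w))
    (hT₁ : T₁ ≠ 0)
    (hM' : IsGKModule (uFormGroup (Fin 2) (Fin 1)) σK' σ𝔤') (hirr' : IsIrreducibleGK σK' σ𝔤')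
    (T₂ : P.archModuleCM ι T hT →ₗ[ℂ] M')
    (hT₂K : ∀ (k : (uFormGroup (Fin 2) (Fin 1)).maximalCompact) (w : P.archModuleCM ι T hT),
      T₂ (P.archRepKCM ι T hT k w) = σK' k (T₂ w))
    (hT₂𝔤 : ∀ (X : (uFormGroup (Fin 2) (Fin 1)).lie) (w : P.archModuleCM ι T hT),
      T₂ (P.archRepLieCM ι T hT X w) = σ𝔤' X (T₂ w))
    (hT₂ : T₂ ≠ 0)
    {δ δ' : ℤ} (hδ : δ = 1 ∨ δ = -1) (hδ' : δ' = 1 ∨ δ' = -1)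
    (hne : upqTypeClasses σK σ𝔤 hM.ad_compat 1 δ ≠ ⊥) (hne' : upqTypeClasses σK' σ𝔤' hM'.ad_compat 1 δ' ≠ ⊥) : δ = δ' := by
  have he := areGKEquivalent_of_tokens ι T hT P hF1a hirr T₁ hT₁K hT₁𝔤 hT₁ hirr' T₂ hT₂K hT₂𝔤 hT₂
  rcases hδ with rfl | rfl <;> rcases hδ' with rfl | rfl
  · rfl
  · exact ((hol_antihol_inequivalent_of_irreducible hM hM' hirr' hne hne') he).elim
  · exact ((antihol_hol_inequivalent_of_irreducible hM hM' hirr' hne hne') he).elim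
  · rfl

end Pin

/-! ## §3 The compact CM datum: F1a in-house, so ONE SIGN PER `H¹`-COHOMOLOGICAL `P` unconditionally -/

section Cpt

variable (L : Type) [Field L] [NumberField L] [IsCMField L] (ι : L →+* ℂ) (H : Matrix (Fin 3) (Fin 3) L) (T : GL (Fin 3) ℂ)
  (hT : (T : Matrix (Fin 3) (Fin 3) ℂ)ᴴ * H.map ι * (T : Matrix (Fin 3) (Fin 3) ℂ) = Literature.Geometry.ComplexHyperbolic.BallModel.J)
  (μ : Measure (adelicGroupData (↥(maximalRealSubfield L)) L (IsCMField.complexConj L) 3 H).automorphicQuotient)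
  [(adelicGroupData (↥(maximalRealSubfield L)) L (IsCMField.complexConj L) 3 H).IsAutomorphicMeasure μ]
  {M : Type} [AddCommGroup M] [Module ℂ M]
  {σK : Representation ℂ (uFormGroup (Fin 2) (Fin 1)).maximalCompact M}
  {σ𝔤 : (uFormGroup (Fin 2) (Fin 1)).lie →ₗ⁅ℝ⁆ Module.End ℂ M}
  {M' : Type} [AddCommGroup M'] [Module ℂ M']
  {σK' : Representation ℂ (uFormGroup (Fin 2) (Fin 1)).maximalCompact M'}
  {σ𝔤' : (uFormGroup (Fin 2) (Fin 1)).lie →ₗ⁅ℝ⁆ Module.End ℂ M'}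

/-- **ONE SIGN PER `H¹`-COHOMOLOGICAL `P`, compact CM datum, UNCONDITIONAL** — `H` definite away from `ι`, `[L⁺:ℚ] ≥ 2`, `P` of
holomorphic OR antiholomorphic cotangent type at `ι`: two tokens of `P` with classes of types `δ, δ′ ∈ {±1}` have `δ = δ′`
(`upqType_eq_of_tokens` over ★ `F0P3StubF1aCM.stubF1aCM_holds` = F1a in-house).  This is the `P = P′` case of the relative sign letter
R♭ `memAPacket_cohTokens_sameType` of PLAN.F0P3g3 §16 (ruling (Q2)), proved without any packet vocabulary.
[cite: Rogawski1990, Prop. 15.2.1 (b); §15.3] [cite: BorelWallach2000, VI Thm. 4.11] [cite: FlathCorvallis1979, Thm. 3] -/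
theorem upqType_eq_of_tokens_cpt
    (hdef : ∀ τ' : L →+* ℂ, InfinitePlace.mk τ' ≠ InfinitePlace.mk ι → (H.map τ').PosDef) (h2 : 2 ≤ Module.finrank ℚ ↥(maximalRealSubfield L))
    (P : DiscreteAutomorphicRep (adelicGroupData (↥(maximalRealSubfield L)) L (IsCMField.complexConj L) 3 H) μ)
    (hP : P.IsHolCotangentAt (cmArchSection L ι H T hT) (cmCompactFactor L ι H T hT) ∨
      P.IsAntiholCotangentAt (cmArchSection L ι H T hT) (cmCompactFactor L ι H T hT))
    (hM : IsGKModule (uFormGroup (Fin 2) (Fin 1)) σK σ𝔤) (hirr : IsIrreducibleGK σK σ𝔤)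
    (T₁ : P.archModuleCM ι T hT →ₗ[ℂ] M)
    (hT₁K : ∀ (k : (uFormGroup (Fin 2) (Fin 1)).maximalCompact) (w : P.archModuleCM ι T hT),
      T₁ (P.archRepKCM ι T hT k w) = σK k (T₁ w))
    (hT₁𝔤 : ∀ (X : (uFormGroup (Fin 2) (Fin 1)).lie) (w : P.archModuleCM ι T hT),
      T₁ (P.archRepLieCM ι T hT X w) = σ𝔤 X (T₁ w))
    (hT₁ : T₁ ≠ 0)
    (hM' : IsGKModule (uFormGroup (Fin 2) (Fin 1)) σK' σ𝔤') (hirr' : IsIrreducibleGK σK' σ𝔤')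
    (T₂ : P.archModuleCM ι T hT →ₗ[ℂ] M')
    (hT₂K : ∀ (k : (uFormGroup (Fin 2) (Fin 1)).maximalCompact) (w : P.archModuleCM ι T hT),
      T₂ (P.archRepKCM ι T hT k w) = σK' k (T₂ w))
    (hT₂𝔤 : ∀ (X : (uFormGroup (Fin 2) (Fin 1)).lie) (w : P.archModuleCM ι T hT),
      T₂ (P.archRepLieCM ι T hT X w) = σ𝔤' X (T₂ w))
    (hT₂ : T₂ ≠ 0)
    {δ δ' : ℤ} (hδ : δ = 1 ∨ δ = -1) (hδ' : δ' = 1 ∨ δ' = -1)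
    (hne : upqTypeClasses σK σ𝔤 hM.ad_compat 1 δ ≠ ⊥) (hne' : upqTypeClasses σK' σ𝔤' hM'.ad_compat 1 δ' ≠ ⊥) : δ = δ' :=
  upqType_eq_of_tokens ι T hT P (F0P3StubF1aCM.stubF1aCM_holds L ι H T hT hdef h2 μ P hP)
    hM hirr T₁ hT₁K hT₁𝔤 hT₁ hM' hirr' T₂ hT₂K hT₂𝔤 hT₂ hδ hδ' hne hne'

/-- **A holomorphic-type `P` has ONLY type-`(+1)` tokens**: for `P` of holomorphic cotangent type at `ι` (compact CM datum), every token
`(M, σK, σ𝔤)` of `P` whose degree-one cohomology has a non-zero class of type `δ ∈ {±1}` has `δ = 1` — compare with the holomorphic token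
of ★ K4 `exists_cohToken_of_isHolCotangentAt_cpt`.  (This is the SHAPE of the D6∕S2♭ archimedean sign clause `… → δ = sgn ξ` of ruling (L1),
discharged with `sgn = +1` for holomorphic `P` and no `ξ`.) [cite: Rogawski1990, Prop. 15.2.1 (b); §15.3] [cite: BorelWallach2000, VI Thm. 4.11] -/
theorem token_type_eq_one_of_isHolCotangentAt_cpt
    (hdef : ∀ τ' : L →+* ℂ, InfinitePlace.mk τ' ≠ InfinitePlace.mk ι → (H.map τ').PosDef) (h2 : 2 ≤ Module.finrank ℚ ↥(maximalRealSubfield L))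
    (P : DiscreteAutomorphicRep (adelicGroupData (↥(maximalRealSubfield L)) L (IsCMField.complexConj L) 3 H) μ)
    (hP : P.IsHolCotangentAt (cmArchSection L ι H T hT) (cmCompactFactor L ι H T hT))
    (hM : IsGKModule (uFormGroup (Fin 2) (Fin 1)) σK σ𝔤) (hirr : IsIrreducibleGK σK σ𝔤)
    (T₁ : P.archModuleCM ι T hT →ₗ[ℂ] M)
    (hT₁K : ∀ (k : (uFormGroup (Fin 2) (Fin 1)).maximalCompact) (w : P.archModuleCM ι T hT),
      T₁ (P.archRepKCM ι T hT k w) = σK k (T₁ w))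
    (hT₁𝔤 : ∀ (X : (uFormGroup (Fin 2) (Fin 1)).lie) (w : P.archModuleCM ι T hT),
      T₁ (P.archRepLieCM ι T hT X w) = σ𝔤 X (T₁ w))
    (hT₁ : T₁ ≠ 0) {δ : ℤ} (hδ : δ = 1 ∨ δ = -1) (hne : upqTypeClasses σK σ𝔤 hM.ad_compat 1 δ ≠ ⊥) : δ = 1 := by
  obtain ⟨M₀, i₁, i₂, σK₀, σ𝔤₀, hM₀, hirr₀, ⟨T₀, hT₀K, hT₀𝔤, hT₀⟩, hne₀⟩ :=
    exists_cohToken_of_isHolCotangentAt_cpt L ι H T hT μ hdef h2 P hP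
  exact upqType_eq_of_tokens_cpt L ι H T hT μ hdef h2 P (Or.inl hP) hM hirr T₁ hT₁K hT₁𝔤 hT₁ hM₀ hirr₀ T₀ hT₀K hT₀𝔤 hT₀
    hδ (Or.inl rfl) hne hne₀

/-- **An antiholomorphic-type `P` has ONLY type-`(−1)` tokens** (the twin, against ★ K4 `exists_cohToken_of_isAntiholCotangentAt_cpt`).
[cite: Rogawski1990, Prop. 15.2.1 (b); §15.3] [cite: BorelWallach2000, VI Thm. 4.11] -/
theorem token_type_eq_neg_one_of_isAntiholCotangentAt_cpt
    (hdef : ∀ τ' : L →+* ℂ, InfinitePlace.mk τ' ≠ InfinitePlace.mk ι → (H.map τ').PosDef) (h2 : 2 ≤ Module.finrank ℚ ↥(maximalRealSubfield L))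
    (P : DiscreteAutomorphicRep (adelicGroupData (↥(maximalRealSubfield L)) L (IsCMField.complexConj L) 3 H) μ)
    (hP : P.IsAntiholCotangentAt (cmArchSection L ι H T hT) (cmCompactFactor L ι H T hT))
    (hM : IsGKModule (uFormGroup (Fin 2) (Fin 1)) σK σ𝔤) (hirr : IsIrreducibleGK σK σ𝔤)
    (T₁ : P.archModuleCM ι T hT →ₗ[ℂ] M)
    (hT₁K : ∀ (k : (uFormGroup (Fin 2) (Fin 1)).maximalCompact) (w : P.archModuleCM ι T hT),
      T₁ (P.archRepKCM ι T hT k w) = σK k (T₁ w))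
    (hT₁𝔤 : ∀ (X : (uFormGroup (Fin 2) (Fin 1)).lie) (w : P.archModuleCM ι T hT),
      T₁ (P.archRepLieCM ι T hT X w) = σ𝔤 X (T₁ w))
    (hT₁ : T₁ ≠ 0) {δ : ℤ} (hδ : δ = 1 ∨ δ = -1) (hne : upqTypeClasses σK σ𝔤 hM.ad_compat 1 δ ≠ ⊥) : δ = -1 := by
  obtain ⟨M₀, i₁, i₂, σK₀, σ𝔤₀, hM₀, hirr₀, ⟨T₀, hT₀K, hT₀𝔤, hT₀⟩, hne₀⟩ :=
    exists_cohToken_of_isAntiholCotangentAt_cpt L ι H T hT μ hdef h2 P hP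
  exact upqType_eq_of_tokens_cpt L ι H T hT μ hdef h2 P (Or.inr hP) hM hirr T₁ hT₁K hT₁𝔤 hT₁ hM₀ hirr₀ T₀ hT₀K hT₀𝔤 hT₀
    hδ (Or.inr rfl) hne hne₀

end Cpt

end Summit.HodgeConjecture.HodgeConjecture.Cruxes.H413.F0P3ArchTokenSeam

end
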